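import Mathlib
import HarnessLib

/-!
# Depth split identity: when does ζ's bottom-`K` frame see a control's negative ground state?
(pub-rhpf THEORY-4 §8.5 "sign depth" / job `t4g3` split columns; mechanism search — no RH claims)

PROVED (kernel) form of the identity behind the `split` columns (`Q_in`, `Q_out`, `cross2`) of the
gen-3 depth tables.  Setting (dictionary THEOREM-informal): `B` = the control's window form `Q_c` on
the even Galerkin block (a symmetric bilinear form), `u` = its ground state, `B u v = ε ⟪u,v⟫` for
all `v` with `ε = ε₁ᶜ < 0`; split `u = uin + uout` with `uin` = orthogonal projection of `u` onto
ζ's bottom-`K` frame and `uout ⟂ uin`, `θ := ‖uout‖²` (outside mass = `1 − cap_K`).  Then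

* `inner_out_eq`          : `⟪u, uout⟫ = ‖uout‖²`;
* `cross_eq`              : `B uout uin = ε‖uout‖² − B uout uout`   (the tabulated `cross2 / 2`);
* `depthSplit_identity`   : `B uin uin = ε (‖u‖² − 2‖uout‖²) + B uout uout`;
* `inside_negative_iff`   : `B uin uin < 0 ↔ B uout uout < −ε (‖u‖² − 2‖uout‖²)` — ζ's bottom-`K`
  frame contains a `Q_c`-negative vector (namely `uin`, so the compression `T_K` is indefinite and the
  SIGN DEPTH is `≤ K`) as soon as the control-energy of the part of its ground state OUTSIDE the frame
  drops below `|ε₁ᶜ|·(1 − 2θ)` (unit `u`).  This is the sufficient half of "first K at which a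
  depth-K frame functional can see the intruder"; the numbers `B uout uout` per `K` are DATA.

Pure linear algebra over a real inner product space ([folklore]); decls in `…PfPersistence.DepthSplit`.
-/

set_option linter.dupNamespace false  -- the mandated namespace repeats `RiemannHypothesis`

noncomputable section

open scoped InnerProductSpace

namespace Summit.RiemannHypothesis.RiemannHypothesis.Theorems.PfPersistence.DepthSplit

variable {E : Type*} [NormedAddCommGroup E] [InnerProductSpace ℝ E]

/-- PROVED: for an orthogonal split `u = uin + uout`, `⟪u, uout⟫ = ‖uout‖²`. [folklore] -/
theorem inner_out_eq (u uin uout : E) (hsplit : u = uin + uout) (horth : ⟪uin, uout⟫_ℝ = 0) :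
    ⟪u, uout⟫_ℝ = ‖uout‖ ^ 2 := by
  rw [hsplit, inner_add_left, horth, zero_add, real_inner_self_eq_norm_sq]

/-- PROVED (the `cross` column): for a symmetric bilinear form `B` with eigen-relation `B u v = ε ⟪u,v⟫`
and an orthogonal split `u = uin + uout`, `B uout uin = ε ‖uout‖² − B uout uout`. [folklore] -/
theorem cross_eq (B : E →ₗ[ℝ] E →ₗ[ℝ] ℝ) (hsymm : ∀ x y, B x y = B y x) (u uin uout : E) (ε : ℝ)
    (heig : ∀ v, B u v = ε * ⟪u, v⟫_ℝ) (hsplit : u = uin + uout) (horth : ⟪uin, uout⟫_ℝ = 0) :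
    B uout uin = ε * ‖uout‖ ^ 2 - B uout uout := by
  have h1 : uin = u - uout := by rw [hsplit]; abel
  have h2 : B uout u = ε * ‖uout‖ ^ 2 := by
    rw [hsymm, heig, inner_out_eq u uin uout hsplit horth]
  rw [h1]
  simp only [map_sub]
  rw [h2]

/-- PROVED (depth split identity): `B uin uin = ε (‖u‖² − 2‖uout‖²) + B uout uout`. [folklore] -/
theorem depthSplit_identity (B : E →ₗ[ℝ] E →ₗ[ℝ] ℝ) (hsymm : ∀ x y, B x y = B y x) (u uin uout : E)
    (ε : ℝ) (heig : ∀ v, B u v = ε * ⟪u, v⟫_ℝ) (hsplit : u = uin + uout) (horth : ⟪uin, uout⟫_ℝ = 0) :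
    B uin uin = ε * (‖u‖ ^ 2 - 2 * ‖uout‖ ^ 2) + B uout uout := by
  have h1 : uin = u - uout := by rw [hsplit]; abel
  have huu : B u u = ε * ‖u‖ ^ 2 := by rw [heig, real_inner_self_eq_norm_sq]
  have huo : B u uout = ε * ‖uout‖ ^ 2 := by rw [heig, inner_out_eq u uin uout hsplit horth]
  have hou : B uout u = ε * ‖uout‖ ^ 2 := by rw [hsymm]; exact huo
  rw [h1]
  simp only [map_sub, LinearMap.sub_apply]
  rw [huu, huo, hou]
  ring

/-- PROVED (detection criterion, conclusion (b)): with the hypotheses of `depthSplit_identity`,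
`B uin uin < 0 ↔ B uout uout < −ε (‖u‖² − 2‖uout‖²)`; for a unit ground state with `ε < 0` the
right side reads `Q_c(uout) < |ε|·(1 − 2θ)`, `θ = ‖uout‖²` the mass outside the frame. [folklore] -/
theorem inside_negative_iff (B : E →ₗ[ℝ] E →ₗ[ℝ] ℝ) (hsymm : ∀ x y, B x y = B y x) (u uin uout : E)
    (ε : ℝ) (heig : ∀ v, B u v = ε * ⟪u, v⟫_ℝ) (hsplit : u = uin + uout) (horth : ⟪uin, uout⟫_ℝ = 0) :
    B uin uin < 0 ↔ B uout uout < -(ε * (‖u‖ ^ 2 - 2 * ‖uout‖ ^ 2)) := by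
  rw [depthSplit_identity B hsymm u uin uout ε heig hsplit horth]
  constructor <;> intro h <;> linarith

/-- PROVED (unit-vector reading): if `‖u‖ = 1`, `ε < 0`, `θ = ‖uout‖²` and
`B uout uout < |ε| (1 − 2θ)` then `B uin uin < 0` — the bottom-`K` frame carries a `B`-negative
vector, so the sign depth is at most `K`. [folklore] -/
theorem inside_negative_of_outEnergy_lt (B : E →ₗ[ℝ] E →ₗ[ℝ] ℝ) (hsymm : ∀ x y, B x y = B y x)
    (u uin uout : E) (ε : ℝ) (heig : ∀ v, B u v = ε * ⟪u, v⟫_ℝ) (hsplit : u = uin + uout)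
    (horth : ⟪uin, uout⟫_ℝ = 0) (hunit : ‖u‖ = 1) (hε : ε < 0)
    (hout : B uout uout < |ε| * (1 - 2 * ‖uout‖ ^ 2)) :
    B uin uin < 0 := by
  rw [inside_negative_iff B hsymm u uin uout ε heig hsplit horth, hunit]
  rw [abs_of_neg hε] at hout
  linarith

end Summit.RiemannHypothesis.RiemannHypothesis.Theorems.PfPersistence.DepthSplit

end
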